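import Literature.NumberTheory.Automorphic.UnitaryGroupCongruenceSubgroupLevels
import Literature.NumberTheory.Automorphic.LocalConstantsProofs
import HarnessLib

/-!
# The principal congruence levels are a neighbourhood basis of `1` in `U(J)(𝔸_{F,f})`;
  continuous characters and eigenvectors are fixed by a deep enough level

Registry: pub-hodgecm MODEL-CONSTRUCTION sub-cell, unitary-group lane (lineage mc-unitary-2, gen 5), MODEL-DAG
node **(W-Kf″)**: the finite-level half of the fields `C.fixN` / `C.level` of the archimedean `K`-type datum.
Companion of `UnitaryGroupCongruenceLevels` (U2-iv: the compact open `K_{U,f}(𝔫) ≤ U(J)(𝔸_{F,f})`) and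
`UnitaryGroupCongruenceSubgroupLevels` (§ 3 there: every OPEN SUBGROUP contains some `K_{U,f}(n𝓞_E)`).

For a quadratic extension `E/F` of number fields with involution `c`, a form `J ∈ M_N(E)` and the finite-adelic
unitary group `U(J)(𝔸_{F,f}) ≤ GL_N(𝔸_E^∞)` (U2-ii `UnitaryGroup.finAdelic`):

* § 1 (`GL_n`): every neighbourhood of `1` in `GL_n(𝔸_K^∞)` contains a finite principal congruence subgroup
  `K_f(𝔫) = ofFinite⁻¹ K(𝔫)`, `𝔫 ≠ 0` (`exists_comap_ofFinite_principalCongruenceLevel_subset`; from the tree's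
  adelic statement `exists_principalCongruenceLevel_subset` and the continuous projection `GL_n(𝔸_K) → GL_n(𝔸_K^∞)`).
* § 2 (`U(J)`): every neighbourhood of `1` in `U(J)(𝔸_{F,f})` contains some `K_{U,f}(𝔫)`, `𝔫 ≠ 0`, and some
  `K_{U,f}(n𝓞_E)`, `n > 0` (`exists_finCongruenceLevel_subset`, `exists_finCongruenceLevel_span_subset`); packaged:
  **the `K_{U,f}(𝔫)`, `𝔫 ≠ 0`, form a basis of neighbourhoods of `1`** (`nhds_one_hasBasis_finCongruenceLevel`).
* § 3 (no small subgroups in `ℂ`): a neighbourhood `V` of `1` in `ℂ` with `(∀ n, zⁿ ∈ V) → z = 1`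
  (`Complex.exists_nhds_one_forall_pow_mem_imp`, from the tree's `unitsComplex_noSmallSubgroups`).
* § 4 (characters and eigenvectors): a homomorphism `χ : U(J)(𝔸_{F,f}) → ℂˣ` continuous at `1` is trivial on
  some `K_{U,f}(𝔫)` (`exists_finCongruenceLevel_le_ker`); a function `χ : U(J)(𝔸_{F,f}) → ℂ` multiplicative on an
  open subgroup `H`, with `χ 1 = 1` and continuous at `1`, is `≡ 1` on some `K_{U,f}(𝔫) ≤ H`
  (`exists_finCongruenceLevel_forall_eq_one`); and the **eigenvector ⇒ fixed vector** principle: if `v` is an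
  eigenvector of every element of an open subgroup `H` under a representation `ρ` of `U(J)(𝔸_{F,f})` whose matrix
  coefficient `g ↦ ℓ (ρ g v)` (`ℓ v = 1`) is continuous at `1`, then `v` is FIXED by some `K_{U,f}(𝔫) ≤ H`
  (`exists_finCongruenceLevel_forall_apply_eq_self`) — the shape in which the finite Weil representation fixes a
  coset indicator under a deep principal congruence level of the unitary group.

All statements are proved (Mathlib and the tree only).

## References

* A. Borel, H. Jacquet, *Automorphic forms and automorphic representations*, Proc. Sympos. Pure Math. 33.1
  (1979), § 4.1 (`G(𝔸_f)` has a basis of neighbourhoods of `1` consisting of compact open subgroups).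
* J. R. Getz, H. Hahn, *An Introduction to Automorphic Representations* (2024), Example 5.1 (pp. 99–100): the
  compact open subgroups of `GL_n(𝔸_ℚ^∞)`; § 2.6.
* V. Platonov, A. Rapinchuk, *Algebraic Groups and Number Theory* (1994), § 5.1 (congruence subgroups
  `G(𝔸_f) ∩ K(𝔫)` form a base of neighbourhoods of the identity).
* D. Montgomery, L. Zippin, *Topological Transformation Groups* (1955), § 2 (no small subgroups).
* C. Mœglin, M.-F. Vignéras, J.-L. Waldspurger, *Correspondances de Howe sur un corps p-adique*, LNM 1291
  (1987), Ch. 2, I.3–I.4 (the Weil representation is smooth: every vector is fixed by an open compact subgroup).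
-/

noncomputable section

open NumberField IsDedekindDomain Topology Filter Set
open scoped Matrix MatrixGroups

namespace Literature.NumberTheory.Automorphic

/-! ## § 1. `GL_n(𝔸_K^∞)`: the finite principal congruence subgroups shrink to `1` -/

section GLnFinite

variable (n : ℕ) (K : Type) [Field K] [NumberField K]

/-- **Every neighbourhood of `1` in `GL_n(𝔸_K^∞)` contains a finite principal congruence subgroup
`K_f(𝔫) = ofFinite⁻¹ K(𝔫)`, `𝔫 ≠ 0`.** Pull the neighbourhood back along the continuous projection
`GL_n(𝔸_K) → GL_n(𝔸_K^∞)`, apply the adelic statement `exists_principalCongruenceLevel_subset`, and use that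
`ofFinite` is a section of the projection (`GLn.sndHom_ofFinite`). Getz–Hahn 2024, Example 5.1 (pp. 99–100);
Bump, *Automorphic forms and representations*, § 3.3. [folklore] -/
theorem exists_comap_ofFinite_principalCongruenceLevel_subset
    {U : Set (GL (Fin n) (FiniteAdeleRing (𝓞 K) K))} (hU : U ∈ 𝓝 (1 : GL (Fin n) (FiniteAdeleRing (𝓞 K) K))) :
    ∃ 𝔫 : Ideal (𝓞 K), 𝔫 ≠ 0 ∧
      (((principalCongruenceLevel n K 𝔫).comap (GLn.ofFinite n K) :
          Subgroup (GL (Fin n) (FiniteAdeleRing (𝓞 K) K))) : Set (GL (Fin n) (FiniteAdeleRing (𝓞 K) K))) ⊆ U := by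
  have hc : Continuous (GLn.sndHom n K) := continuous_snd.generalLinearGroup_map
  have hU' : (GLn.sndHom n K) ⁻¹' U ∈ 𝓝 (1 : GL (Fin n) (AdeleRing (𝓞 K) K)) :=
    hc.continuousAt.preimage_mem_nhds (by rwa [map_one])
  obtain ⟨𝔫, h𝔫, hsub⟩ := exists_principalCongruenceLevel_subset n K hU'
  refine ⟨𝔫, h𝔫, fun g hg => ?_⟩
  have h := hsub (show GLn.ofFinite n K g ∈ (principalCongruenceLevel n K 𝔫 : Set _) from hg)
  rwa [Set.mem_preimage, GLn.sndHom_ofFinite] at h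

end GLnFinite

/-! ## § 2. `U(J)(𝔸_{F,f})`: the `K_{U,f}(𝔫)` form a neighbourhood basis of `1` -/

namespace UnitaryGroup

variable {F E : Type} [Field F] [Field E] [NumberField E] [Algebra F E]
  {c : E ≃ₐ[F] E} {N : ℕ} {J : Matrix (Fin N) (Fin N) E}

/-- **Every neighbourhood of `1` in `U(J)(𝔸_{F,f})` contains a principal finite congruence level `K_{U,f}(𝔫)`,
`𝔫 ≠ 0`** (`U(J)(𝔸_{F,f})` carries the subspace topology of `GL_N(𝔸_E^∞)`, and `K_{U,f}(𝔫) = U ∩ K_f(𝔫)`).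
Platonov–Rapinchuk 1994, § 5.1; Borel–Jacquet 1979, § 4.1. [cite: PlatonovRapinchuk1994, §5.1] -/
theorem exists_finCongruenceLevel_subset {U : Set (finAdelic F E c N J)} (hU : U ∈ 𝓝 (1 : finAdelic F E c N J)) :
    ∃ 𝔫 : Ideal (𝓞 E), 𝔫 ≠ 0 ∧ (finCongruenceLevel F E c N J 𝔫 : Set (finAdelic F E c N J)) ⊆ U := by
  rw [Topology.IsInducing.subtypeVal.nhds_eq_comap, Filter.mem_comap] at hU
  obtain ⟨V, hV, hVU⟩ := hU
  obtain ⟨𝔫, h𝔫, hsub⟩ := exists_comap_ofFinite_principalCongruenceLevel_subset N E hV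
  refine ⟨𝔫, h𝔫, fun g hg => hVU ?_⟩
  exact hsub ((mem_finCongruenceLevel_iff F E c N J 𝔫 g).1 hg)

/-- Natural-number form: every neighbourhood of `1` in `U(J)(𝔸_{F,f})` contains some `K_{U,f}(n𝓞_E)`, `n > 0`
(take `n = N(𝔫)`, `finCongruenceLevel_span_absNorm_le`). [cite: PlatonovRapinchuk1994, §5.1] -/
theorem exists_finCongruenceLevel_span_subset {U : Set (finAdelic F E c N J)}
    (hU : U ∈ 𝓝 (1 : finAdelic F E c N J)) :
    ∃ n : ℕ, n ≠ 0 ∧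
      (finCongruenceLevel F E c N J (Ideal.span {(n : 𝓞 E)}) : Set (finAdelic F E c N J)) ⊆ U := by
  obtain ⟨𝔫, h𝔫, hsub⟩ := exists_finCongruenceLevel_subset hU
  exact ⟨Ideal.absNorm 𝔫, Ideal.absNorm_eq_zero_iff.not.2 (by rwa [← Ideal.zero_eq_bot]),
    fun g hg => hsub (finCongruenceLevel_span_absNorm_le h𝔫 hg)⟩

/-- **The principal finite congruence levels `K_{U,f}(𝔫)`, `𝔫 ≠ 0`, form a basis of neighbourhoods of `1` in
`U(J)(𝔸_{F,f})`** (each is open, `isOpen_finCongruenceLevel`, and every neighbourhood contains one).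
Platonov–Rapinchuk 1994, § 5.1; Borel–Jacquet 1979, § 4.1. [cite: PlatonovRapinchuk1994, §5.1] -/
theorem nhds_one_hasBasis_finCongruenceLevel :
    (𝓝 (1 : finAdelic F E c N J)).HasBasis (fun 𝔫 : Ideal (𝓞 E) => 𝔫 ≠ 0)
      (fun 𝔫 => (finCongruenceLevel F E c N J 𝔫 : Set (finAdelic F E c N J))) := by
  refine Filter.hasBasis_iff.2 fun U => ⟨fun hU => ?_, fun ⟨𝔫, h𝔫, hsub⟩ => ?_⟩
  · obtain ⟨𝔫, h𝔫, hsub⟩ := exists_finCongruenceLevel_subset hU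
    exact ⟨𝔫, h𝔫, hsub⟩
  · exact Filter.mem_of_superset ((isOpen_finCongruenceLevel F E c N J h𝔫).mem_nhds (Subgroup.one_mem _)) hsub

/-- A principal finite congruence level of nonzero level is a neighbourhood of `1`. [folklore] -/
theorem finCongruenceLevel_mem_nhds_one {𝔫 : Ideal (𝓞 E)} (h𝔫 : 𝔫 ≠ 0) :
    (finCongruenceLevel F E c N J 𝔫 : Set (finAdelic F E c N J)) ∈ 𝓝 (1 : finAdelic F E c N J) :=
  (isOpen_finCongruenceLevel F E c N J h𝔫).mem_nhds (Subgroup.one_mem _)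

end UnitaryGroup

/-! ## § 3. No small subgroups in `ℂ` (power form) -/

/-- **`ℂ` has no small multiplicative subgroups** (power form, `ℂ`-valued): there is a neighbourhood `V` of `1`
in `ℂ` such that `z = 1` as soon as all powers `zⁿ`, `n ∈ ℕ`, lie in `V`. From the `ℂˣ` statement
`unitsComplex_noSmallSubgroups` and the open embedding `ℂˣ → ℂ` (`Units.isOpenMap_val`). Montgomery–Zippin
1955, § 2; Tate, Corvallis 1979, (2.2). [folklore] -/
theorem Complex.exists_nhds_one_forall_pow_mem_imp :
    ∃ V : Set ℂ, V ∈ 𝓝 (1 : ℂ) ∧ ∀ z : ℂ, (∀ n : ℕ, z ^ n ∈ V) → z = 1 := by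
  obtain ⟨W, hWo, h1W, hW⟩ := unitsComplex_noSmallSubgroups
  refine ⟨((↑) : ℂˣ → ℂ) '' W, (Units.isOpenMap_val W hWo).mem_nhds ⟨1, h1W, Units.val_one⟩, fun z hz => ?_⟩
  obtain ⟨u, -, huz⟩ := hz 1
  rw [pow_one] at huz
  have key : ∀ n : ℕ, u ^ n ∈ W := fun n => by
    obtain ⟨w, hwW, hw⟩ := hz n
    have hwu : w = u ^ n := Units.val_injective (by rw [hw, Units.val_pow_eq_pow_val, huz])
    exact hwu ▸ hwW
  rw [← huz, hW u key, Units.val_one]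

/-! ## § 4. Characters and eigenvectors are fixed by a deep enough level -/

namespace UnitaryGroup

variable {F E : Type} [Field F] [Field E] [NumberField E] [Algebra F E]
  {c : E ≃ₐ[F] E} {N : ℕ} {J : Matrix (Fin N) (Fin N) E}

/-- **A homomorphism `χ : U(J)(𝔸_{F,f}) → ℂˣ` continuous at `1` is trivial on some `K_{U,f}(𝔫)`, `𝔫 ≠ 0`**
(no small subgroups in `ℂˣ`: the subgroup `K_{U,f}(𝔫) ⊆ χ⁻¹(N)` is killed). Tate, Corvallis 1979, (2.2);
Montgomery–Zippin 1955, § 2. [folklore] -/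
theorem exists_finCongruenceLevel_le_ker (χ : finAdelic F E c N J →* ℂˣ) (hχ : ContinuousAt χ 1) :
    ∃ 𝔫 : Ideal (𝓞 E), 𝔫 ≠ 0 ∧ finCongruenceLevel F E c N J 𝔫 ≤ χ.ker := by
  obtain ⟨W, hWo, h1W, hW⟩ := unitsComplex_noSmallSubgroups
  have hpre : (χ : finAdelic F E c N J → ℂˣ) ⁻¹' W ∈ 𝓝 (1 : finAdelic F E c N J) :=
    hχ.preimage_mem_nhds (hWo.mem_nhds (by rwa [map_one]))
  obtain ⟨𝔫, h𝔫, hsub⟩ := exists_finCongruenceLevel_subset hpre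
  refine ⟨𝔫, h𝔫, fun k hk => (MonoidHom.mem_ker).2 (hW (χ k) fun m => ?_)⟩
  rw [← map_pow]
  exact hsub (Subgroup.pow_mem _ hk m)

/-- **A function `χ : U(J)(𝔸_{F,f}) → ℂ` which is multiplicative on an open subgroup `H`, with `χ 1 = 1` and
continuous at `1`, is identically `1` on some `K_{U,f}(𝔫) ≤ H`, `𝔫 ≠ 0`** (its powers along the subgroup
`K_{U,f}(𝔫) ⊆ H ∩ χ⁻¹(V)` stay in the no-small-subgroups neighbourhood `V` of § 3). Tate, Corvallis 1979, (2.2).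
[folklore] -/
theorem exists_finCongruenceLevel_forall_eq_one {H : Subgroup (finAdelic F E c N J)}
    (hH : IsOpen (H : Set (finAdelic F E c N J))) (χ : finAdelic F E c N J → ℂ) (h1 : χ 1 = 1)
    (hmul : ∀ a ∈ H, ∀ b ∈ H, χ (a * b) = χ a * χ b) (hχ : ContinuousAt χ 1) :
    ∃ 𝔫 : Ideal (𝓞 E), 𝔫 ≠ 0 ∧ finCongruenceLevel F E c N J 𝔫 ≤ H ∧
      ∀ k ∈ finCongruenceLevel F E c N J 𝔫, χ k = 1 := by
  obtain ⟨V, hV, hVpow⟩ := Complex.exists_nhds_one_forall_pow_mem_imp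
  have hpre : χ ⁻¹' V ∩ (H : Set (finAdelic F E c N J)) ∈ 𝓝 (1 : finAdelic F E c N J) :=
    Filter.inter_mem (hχ.preimage_mem_nhds (by rwa [h1])) (hH.mem_nhds H.one_mem)
  obtain ⟨𝔫, h𝔫, hsub⟩ := exists_finCongruenceLevel_subset hpre
  have hle : finCongruenceLevel F E c N J 𝔫 ≤ H := fun k hk => (hsub hk).2
  refine ⟨𝔫, h𝔫, hle, fun k hk => hVpow (χ k) fun m => ?_⟩
  -- `χ (k ^ m) = (χ k) ^ m` by multiplicativity on `H ∋ k`
  have hpow : ∀ m : ℕ, χ (k ^ m) = χ k ^ m := by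
    intro m
    induction m with
    | zero => rw [pow_zero, pow_zero, h1]
    | succ m ih => rw [pow_succ, hmul _ (H.pow_mem (hle hk) m) _ (hle hk), ih, pow_succ]
  rw [← hpow m]
  exact (hsub (Subgroup.pow_mem _ hk m)).1

/-- **Eigenvector ⇒ fixed vector.** Let `ρ` be a representation of `U(J)(𝔸_{F,f})` on a `ℂ`-module `M`, `v ∈ M`,
and `ℓ : M →ₗ[ℂ] ℂ` with `ℓ v = 1`. If `v` is an eigenvector of `ρ h` for every `h` in an OPEN subgroup `H`, and
the matrix coefficient `g ↦ ℓ (ρ g v)` is continuous at `1`, then `v` is FIXED by a principal finite congruence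
level: `ρ k v = v` for all `k ∈ K_{U,f}(𝔫)`, some `𝔫 ≠ 0` with `K_{U,f}(𝔫) ≤ H` (the eigencharacter
`h ↦ ℓ (ρ h v)` is continuous at `1`, hence trivial near `1` by `exists_finCongruenceLevel_forall_eq_one`). This is
the mechanism by which a vector of the (smooth) finite Weil representation on which a compact open subgroup acts
through a character is fixed by a deeper compact open subgroup. MVW 1987, Ch. 2, I.3–I.4; Borel–Jacquet 1979,
§ 4.1. [folklore] -/
theorem exists_finCongruenceLevel_forall_apply_eq_self {M : Type*} [AddCommGroup M] [Module ℂ M]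
    (ρ : Representation ℂ (finAdelic F E c N J) M) (v : M) (ℓ : M →ₗ[ℂ] ℂ) (hℓ : ℓ v = 1)
    {H : Subgroup (finAdelic F E c N J)} (hH : IsOpen (H : Set (finAdelic F E c N J)))
    (heig : ∀ h ∈ H, ∃ t : ℂ, ρ h v = t • v) (hcont : ContinuousAt (fun g => ℓ (ρ g v)) 1) :
    ∃ 𝔫 : Ideal (𝓞 E), 𝔫 ≠ 0 ∧ finCongruenceLevel F E c N J 𝔫 ≤ H ∧
      ∀ k ∈ finCongruenceLevel F E c N J 𝔫, ρ k v = v := by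
  -- the eigenvalue of `h ∈ H` is the matrix coefficient `ℓ (ρ h v)`
  have hval : ∀ h ∈ H, ρ h v = (ℓ (ρ h v)) • v := by
    intro h hh
    obtain ⟨t, ht⟩ := heig h hh
    rw [ht, map_smul, hℓ, smul_eq_mul, mul_one]
  have h1 : ℓ (ρ 1 v) = 1 := by rw [map_one, Module.End.one_apply, hℓ]
  have hmul : ∀ a ∈ H, ∀ b ∈ H, ℓ (ρ (a * b) v) = ℓ (ρ a v) * ℓ (ρ b v) := by
    intro a ha b hb
    obtain ⟨s, hs⟩ := heig a ha
    obtain ⟨t, ht⟩ := heig b hb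
    have hs' : ℓ (ρ a v) = s := by rw [hs, map_smul, hℓ, smul_eq_mul, mul_one]
    have ht' : ℓ (ρ b v) = t := by rw [ht, map_smul, hℓ, smul_eq_mul, mul_one]
    rw [hs', ht', map_mul, Module.End.mul_apply, ht, map_smul, hs, map_smul, map_smul, hℓ, smul_eq_mul,
      smul_eq_mul, mul_one, mul_comm]
  obtain ⟨𝔫, h𝔫, hle, hone⟩ :=
    exists_finCongruenceLevel_forall_eq_one hH (fun g => ℓ (ρ g v)) h1 hmul hcont
  refine ⟨𝔫, h𝔫, hle, fun k hk => ?_⟩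
  rw [hval k (hle hk), hone k hk, one_smul]

/-- Corollary in `hfix` shape, natural-number level: under the hypotheses of
`exists_finCongruenceLevel_forall_apply_eq_self`, `v` is fixed by some `K_{U,f}(n𝓞_E) ≤ H`, `n > 0`.
[folklore] -/
theorem exists_finCongruenceLevel_span_forall_apply_eq_self {M : Type*} [AddCommGroup M] [Module ℂ M]
    (ρ : Representation ℂ (finAdelic F E c N J) M) (v : M) (ℓ : M →ₗ[ℂ] ℂ) (hℓ : ℓ v = 1)
    {H : Subgroup (finAdelic F E c N J)} (hH : IsOpen (H : Set (finAdelic F E c N J)))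
    (heig : ∀ h ∈ H, ∃ t : ℂ, ρ h v = t • v) (hcont : ContinuousAt (fun g => ℓ (ρ g v)) 1) :
    ∃ n : ℕ, n ≠ 0 ∧ finCongruenceLevel F E c N J (Ideal.span {(n : 𝓞 E)}) ≤ H ∧
      ∀ k ∈ finCongruenceLevel F E c N J (Ideal.span {(n : 𝓞 E)}), ρ k v = v := by
  obtain ⟨𝔫, h𝔫, hle, hfix⟩ := exists_finCongruenceLevel_forall_apply_eq_self ρ v ℓ hℓ hH heig hcont
  exact ⟨Ideal.absNorm 𝔫, Ideal.absNorm_eq_zero_iff.not.2 (by rwa [← Ideal.zero_eq_bot]),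
    (finCongruenceLevel_span_absNorm_le h𝔫).trans hle,
    fun k hk => hfix k (finCongruenceLevel_span_absNorm_le h𝔫 hk)⟩

end UnitaryGroup

end Literature.NumberTheory.Automorphic

end
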